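import Literature.NumberTheory.EllipticCurves.PAdicBSD
import HarnessLib

/-!
# The cyclotomic-variable normalisation `IsCyclotomicVariable p γ` is RIGID under re-keying:
# `γ ↦ γ⁻¹` (and every `γ ↦ γⁿ`, `n ≠ 1`) leaves it — proofs only

A `…Proofs` sibling (theorems only: no definition, no named fact, no `instance`, no notation) of
`Literature/NumberTheory/EllipticCurves/PAdicBSD.lean`, item `IsCyclotomicVariable` (l. 227):
`IsCyclotomicVariable p γ :↔ ∃ ζ ∈ μ(ℤ_p), χ_p(γ)·ζ = γ_cyc` with `γ_cyc = cyclotomicGenerator p = 1 + p^{e₀}`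
(Mazur–Tate–Teitelbaum 1986, §I.13: the variable `T = γ_cyc − 1` of `L_p(E,T)`).

WHAT IS PROVED (all elementary; the one arithmetic input is that the natural number `γ_cyc = 1 + p^{e₀} > 1`
is not a root of unity in the characteristic-zero domain `ℤ_p`):
* `one_lt_cyclotomicGenerator`, `not_isOfFinOrder_of_val_eq_cyclotomicGenerator` — a unit of `ℤ_p` with
  value `γ_cyc` has infinite order;
* `IsCyclotomicVariable.not_isOfFinOrder_cyclotomicCharacter` — if `γ` matches the cyclotomic variable
  then `χ_p(γ) ∈ ℤ_pˣ` has infinite order (so `γ` has infinite image in `Γ = Gal(ℚ_∞/ℚ)`);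
* `IsCyclotomicVariable.isOfFinOrder_cyclotomicCharacter_inv_mul` — two matching elements differ by
  torsion: `χ_p(γ⁻¹γ') ∈ μ(ℤ_p)` (the unit-level form of
  `ZpExtension.IsCyclotomic.inv_mul_mem_kerSubgroup_of_isCyclotomicVariable` of
  `IwasawaCharCoeffNormProofs.lean`, without the `κ`);
* `IsCyclotomicVariable.eq_one_of_zpow` / `.eq_one_of_pow` — if `γ` and `γⁿ` both match, then `n = 1`;
* `IsCyclotomicVariable.not_inv` — **if `γ` matches the cyclotomic variable then `γ⁻¹` does NOT**;
  `not_isCyclotomicVariable_one` — `1` never does.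

WHY (cell `bsd-print-x8`, route `PrintX8VSC`, referee note N-287b of REF-AUDIT R-287, 2026-08-28): the
print-keyed (contragredient) route package keys Sprung's ♯/♭ Pontryagin duals by `γ⁻¹`
(`SharpFlatSelmerDualData W κ γ⁻¹ …`) while every `γ`-universal named fact of the tree (Sprung 2024 Lemma 5.9,
Burungale–Kobayashi–Ota Cor. A.5, the control facts, Main Conj. 7.21 as the leaf
`Theorems.SprungSharpFlatMainConjecture`) carries the binder pair `κ.IsTopGenerator γ → IsCyclotomicVariable p γ`
for the SAME `γ` that keys its datum. The referee's rule «no `γ`-universal fact can be instantiated at key `γ⁻¹`;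
ports must pass through the `ι`-twist dictionary
(`Sprung2012/SharpFlatSelmerDualInvolutionTwistProofs.lean`) or through `_contra` twins» rests on the sentence
«`IsCyclotomicVariable p γ⁻¹` is FALSE (given `IsCyclotomicVariable p γ`)», stated in prose with a pointer to
l. 227. `IsCyclotomicVariable.not_inv` below is that sentence as a kernel theorem, and `eq_one_of_zpow` is its
sharp form (no power of `γ` other than `γ` itself is admissible). Nothing about any curve, Selmer group or
`L`-function is asserted; BSD and the route's cruxes are untouched.

References: [MazurTateTeitelbaum1986Invent] §I.13 (the variable of `L_p`); [Washington1997] §7.2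
(`ℤ_pˣ = μ × (1 + p^{e₀}ℤ_p)`); x8 REF-AUDIT R-287 note N-287b (the rule served).
-/

set_option autoImplicit false

namespace Literature.NumberTheory.EllipticCurves

open Literature.NumberTheory.GaloisRepresentations

variable {p : ℕ} [Fact p.Prime]

/-! ## §1 `γ_cyc = 1 + p^{e₀}` is not a root of unity in `ℤ_p` -/

variable (p) in
/-- `1 < γ_cyc = 1 + p^{e₀}` (`γ_cyc = 1 + p` for odd `p`, `5` for `p = 2`; the topological generator of
`1 + p^{e₀}ℤ_p`, Washington §7.2, Mazur–Tate–Teitelbaum §I.13). [cite: Washington1997, §7.2] -/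
theorem one_lt_cyclotomicGenerator : 1 < cyclotomicGenerator p := by
  have h : 0 < p ^ cyclotomicExponent p := pow_pos (Nat.Prime.pos Fact.out) _
  unfold cyclotomicGenerator
  omega

/-- **A unit of `ℤ_p` whose value is `γ_cyc` has infinite order**: `uᵐ = 1` with `m ≥ 1` would give
`γ_cycᵐ = 1` in the characteristic-zero ring `ℤ_p`, i.e. `γ_cyc = 1` in `ℕ`, contradicting `γ_cyc > 1`.
(Equivalently: `γ_cyc` topologically generates the torsion-free part `1 + p^{e₀}ℤ_p` of `ℤ_pˣ`,
Washington §7.2.) [cite: Washington1997, §7.2] -/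
theorem not_isOfFinOrder_of_val_eq_cyclotomicGenerator {u : ℤ_[p]ˣ}
    (hu : (u : ℤ_[p]) = (cyclotomicGenerator p : ℤ_[p])) : ¬ IsOfFinOrder u := by
  intro hfin
  obtain ⟨m, hm, hpow⟩ := hfin.exists_pow_eq_one
  have h := congrArg (fun v : ℤ_[p]ˣ ↦ (v : ℤ_[p])) hpow
  simp only [Units.val_pow_eq_pow_val, Units.val_one, hu] at h
  rw [← Nat.cast_pow, Nat.cast_eq_one, pow_eq_one_iff] at h
  rcases h with h | h
  · exact (one_lt_cyclotomicGenerator p).ne' h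
  · exact hm.ne' h

/-! ## §2 Consequences for `IsCyclotomicVariable` -/

namespace IsCyclotomicVariable

/-- **If `γ ∈ Γ_ℚ` matches the cyclotomic variable, `χ_p(γ) ∈ ℤ_pˣ` has infinite order**: from
`χ_p(γ)·ζ = γ_cyc` with `ζ` torsion, a torsion `χ_p(γ)` would make the unit `χ_p(γ)·ζ` of value `γ_cyc`
torsion (`not_isOfFinOrder_of_val_eq_cyclotomicGenerator`). In print: the image of `γ` in
`Gal(ℚ_∞/ℚ) ≅ 1 + p^{e₀}ℤ_p` is the topological generator `γ_cyc` (Mazur–Tate–Teitelbaum §I.13).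
[cite: MazurTateTeitelbaum1986Invent, §I.13] -/
theorem not_isOfFinOrder_cyclotomicCharacter {γ : Field.absoluteGaloisGroup ℚ}
    (hγ : IsCyclotomicVariable p γ) :
    ¬ IsOfFinOrder (GaloisRep.cyclotomicCharacter ℚ p γ) := by
  obtain ⟨ζ, hζ, h⟩ := hγ
  exact fun hfin ↦ not_isOfFinOrder_of_val_eq_cyclotomicGenerator h (hfin.mul hζ)

/-- **Two elements matching the cyclotomic variable differ by torsion**: `χ_p(γ⁻¹γ') = ζζ'⁻¹ ∈ μ(ℤ_p)`
from `χ_p(γ)·ζ = γ_cyc = χ_p(γ')·ζ'` — the unit-level form (no `κ`) of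
`ZpExtension.IsCyclotomic.inv_mul_mem_kerSubgroup_of_isCyclotomicVariable`; i.e. `γ` and `γ'` have the same
image in `Γ = Gal(ℚ_∞/ℚ) = Γ_ℚ / χ_p⁻¹(μ(ℤ_p))` (Mazur–Tate–Teitelbaum §I.13).
[cite: MazurTateTeitelbaum1986Invent, §I.13] -/
theorem isOfFinOrder_cyclotomicCharacter_inv_mul {γ γ' : Field.absoluteGaloisGroup ℚ}
    (hγ : IsCyclotomicVariable p γ) (hγ' : IsCyclotomicVariable p γ') :
    IsOfFinOrder (GaloisRep.cyclotomicCharacter ℚ p (γ⁻¹ * γ')) := by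
  obtain ⟨ζ, hζ, h⟩ := hγ
  obtain ⟨ζ', hζ', h'⟩ := hγ'
  have hu : GaloisRep.cyclotomicCharacter ℚ p γ * ζ = GaloisRep.cyclotomicCharacter ℚ p γ' * ζ' :=
    Units.ext (h.trans h'.symm)
  have hquot : GaloisRep.cyclotomicCharacter ℚ p (γ⁻¹ * γ') = ζ * ζ'⁻¹ := by
    rw [map_mul, map_inv]
    calc (GaloisRep.cyclotomicCharacter ℚ p γ)⁻¹ * GaloisRep.cyclotomicCharacter ℚ p γ'
        = (GaloisRep.cyclotomicCharacter ℚ p γ)⁻¹ * (GaloisRep.cyclotomicCharacter ℚ p γ' * ζ') * ζ'⁻¹ := by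
          group
      _ = (GaloisRep.cyclotomicCharacter ℚ p γ)⁻¹ * (GaloisRep.cyclotomicCharacter ℚ p γ * ζ) * ζ'⁻¹ := by
          rw [hu]
      _ = ζ * ζ'⁻¹ := by group
  rw [hquot]
  exact hζ.mul hζ'.inv

/-- **Rigidity under re-keying by powers**: if `γ` and `γⁿ` (`n : ℤ`) both match the cyclotomic variable,
then `n = 1`. Indeed `χ_p(γ⁻¹γⁿ) = χ_p(γ)^{n−1}` is torsion (`isOfFinOrder_cyclotomicCharacter_inv_mul`),
and for `n ≠ 1` this forces `χ_p(γ)` torsion, contradicting `not_isOfFinOrder_cyclotomicCharacter`. In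
print: `γ_cycⁿ ≠ γ_cyc · (torsion)` in `ℤ_pˣ` unless `n = 1` (Mazur–Tate–Teitelbaum §I.13; Washington §7.2).
[cite: MazurTateTeitelbaum1986Invent, §I.13] -/
theorem eq_one_of_zpow {γ : Field.absoluteGaloisGroup ℚ} (hγ : IsCyclotomicVariable p γ) {n : ℤ}
    (hn : IsCyclotomicVariable p (γ ^ n)) : n = 1 := by
  by_contra hne
  have htors := isOfFinOrder_cyclotomicCharacter_inv_mul hγ hn
  have hpow : γ⁻¹ * γ ^ n = γ ^ (n - 1) := by group
  rw [hpow, map_zpow] at htors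
  obtain ⟨m, hm, hm1⟩ := isOfFinOrder_iff_zpow_eq_one.mp htors
  refine not_isOfFinOrder_cyclotomicCharacter hγ (isOfFinOrder_iff_zpow_eq_one.mpr ⟨(n - 1) * m, ?_, ?_⟩)
  · exact mul_ne_zero (sub_ne_zero.mpr hne) hm
  · rw [zpow_mul, hm1]

/-- **Rigidity under re-keying by natural powers**: if `γ` and `γⁿ` (`n : ℕ`) both match the cyclotomic
variable, then `n = 1` (`eq_one_of_zpow` at `n : ℤ`). [cite: MazurTateTeitelbaum1986Invent, §I.13] -/
theorem eq_one_of_pow {γ : Field.absoluteGaloisGroup ℚ} (hγ : IsCyclotomicVariable p γ) {n : ℕ}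
    (hn : IsCyclotomicVariable p (γ ^ n)) : n = 1 := by
  have h := eq_one_of_zpow hγ (n := (n : ℤ)) (by rwa [zpow_natCast])
  exact_mod_cast h

/-- **N-287b as a kernel theorem — `IsCyclotomicVariable p γ⁻¹` is FALSE once `IsCyclotomicVariable p γ`
holds**: the contragredient key `γ⁻¹` never satisfies the cyclotomic-variable normalisation of the key `γ`
(`eq_one_of_zpow` at `n = −1`: `χ_p(γ)⁻¹·ζ' = γ_cyc = χ_p(γ)·ζ` would make `χ_p(γ)² = ζ'ζ⁻¹` torsion).
Hence no `γ`-universal named fact whose binders carry `IsCyclotomicVariable p γ` together with a datum keyed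
by the same `γ` can be instantiated at the key `γ⁻¹` of a print-keyed datum; transfers between the two keys
must go through the Iwasawa-involution dictionary
(`Sprung2012.sharpFlatSelmerDualData_charIdeal_inv_eq` etc.) — x8 REF-AUDIT R-287, note N-287b.
[cite: MazurTateTeitelbaum1986Invent, §I.13] -/
theorem not_inv {γ : Field.absoluteGaloisGroup ℚ} (hγ : IsCyclotomicVariable p γ) :
    ¬ IsCyclotomicVariable p γ⁻¹ := by
  intro hinv
  have h := eq_one_of_zpow hγ (n := -1) (by rwa [zpow_neg_one])
  omega

end IsCyclotomicVariable

variable (p) in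
/-- **The identity never matches the cyclotomic variable**: `χ_p(1) = 1` is torsion
(`IsCyclotomicVariable.not_isOfFinOrder_cyclotomicCharacter`); equivalently `γ_cyc ∉ μ(ℤ_p)`.
[cite: MazurTateTeitelbaum1986Invent, §I.13] -/
theorem not_isCyclotomicVariable_one : ¬ IsCyclotomicVariable p (1 : Field.absoluteGaloisGroup ℚ) := by
  intro h
  exact h.not_isOfFinOrder_cyclotomicCharacter (by rw [map_one]; exact IsOfFinOrder.one)

/-- **Two matching elements are never mutually inverse**: `IsCyclotomicVariable p γ → IsCyclotomicVariable p γ'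
→ γ' ≠ γ⁻¹` (restatement of `IsCyclotomicVariable.not_inv` for two named keys, the shape met when a
`γ`-keyed fact and a `γ'`-keyed print datum are both in context). [cite: MazurTateTeitelbaum1986Invent, §I.13] -/
theorem IsCyclotomicVariable.ne_inv {γ γ' : Field.absoluteGaloisGroup ℚ} (hγ : IsCyclotomicVariable p γ)
    (hγ' : IsCyclotomicVariable p γ') : γ' ≠ γ⁻¹ := by
  rintro rfl
  exact hγ.not_inv hγ'

end Literature.NumberTheory.EllipticCurves
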